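import Summits.ABC.ABC.Theorems.IUTThetaPilotGenEllTwoMenuCovering
import Summits.ABC.ABC.Theorems.IUTThetaPilotGenEllTwoMenuPersistence
import Summits.ABC.ABC.Theorems.IUTThetaPilotGenEllTwoMenuChebyshev
import Mathlib.NumberTheory.Padics.Complex
import Mathlib.NumberTheory.NumberField.InfinitePlace.Embeddings
import HarnessLib

set_option linter.dupNamespace false

/-!
# Route `route-ABC-IUTThetaPilot`, support item `GenEllTwo` (stmt-ABC-19679) — helper.
# [GenEll] Thm. 2.1, (ii) ⇒ (i): the MENU COVERING LEMMA, assembled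

S. Mochizuki, *Arithmetic elliptic curves in general position*, Math. J. Okayama Univ. **52** (2010)
[cite: MochizukiGenEll2010], proof of Thm. 2.1 p. 12.  The number-field-only replacement of the
compactness step (package GENELLTWO-P1ROUTE §4, cell abc-iut), DEPTH 2:

**Theorem (`exists_menu_cover`).**  Let `K₀` be a number field, `X ⊂ K₀` a finite set with
`0, 1 ∉ X` (the `x`-coordinates of the special fibre of the noncritical Belyi map), read in two
algebraically closed normed fields `E₁, E₂` of characteristic zero (`ℂ` and `Q̄_2`) through
`τᵢ : K₀ →+* Eᵢ`, and let `k ∈ ℕ` (the number of conjugate slots, `2d`).  Then there are menus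
`PA`, `PC` of more than `k` odd primes and a radius `r > 0` such that for ANY `≤ k` slots
`Z₁ ⊂ E₁`, `Z₂ ⊂ E₂` some member `γ_{n,p} : z ↦ ((C_n(4z − 2) + 2)/4)^p` (`n ∈ PC`, `p ∈ PA`;
a cusp-preserving Belyi map of `ℙ¹ ∖ {0,1,∞}` of degree `n·p`) of the menu moves EVERY slot to
distance `≥ r` from `τᵢ(X)`.

Assembly of: the abstract covering lemma (`MenuCovering`: `exists_radii`, `exists_good_pair₂`,
`localizes_eval`, `finite_preimage_eval`), the outer power-family persistence
(`MenuPersistence`: `exists_prime_menu`, `exists_ratio_bound`, `outer_persistence`,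
`finite_outerPersistent`) and the inner Chebyshev persistence (`MenuChebyshev`:
`inner_persistence`, with the splitting field of the quadratics `Z² − (4ζ−2)Z + 1` over the
persistent roots of unity `ζ`).  Theorems only.  Classical; nothing here bears on [IUTchIII]
Cor. 3.12.
-/

noncomputable section

open NumberField Height Polynomial

universe u v w

namespace Summit.ABC.ABC.Theorems.GenEllTwo.MenuCovering

/-- The radii of `exists_radii` for the ACTUAL menu families in one algebraically closed normed
field `E` of characteristic zero: outer `u ↦ u^p` (`p ∈ PA`), inner `u ↦ (C_n(4u−2)+2)/4`
(`n ∈ PC`), bad set `τ(X)`, persistent set `τ(T₀)`. [cite: MochizukiGenEll2010, Thm 2.1 p.12] -/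
theorem exists_radii_menu {K₀ : Type*} [Field K₀] [NumberField K₀]
    {K₁ : Type*} [Field K₁] [NumberField K₁] [Algebra K₀ K₁]
    (X : Finset K₀) (h0 : (0 : K₀) ∉ X)
    {RA : ℝ} (hRA : ∀ a ∈ X, ∀ a' ∈ X, 0 < logHeight₁ a' → logHeight₁ a ≤ RA * logHeight₁ a')
    (PA : Finset ℕ) (hPA : ∀ p ∈ PA, p.Prime)
    (hPAgrow : ∀ p ∈ PA, ∀ p' ∈ PA, p < p' → RA * p < p')
    (T₀ : Finset K₀) (hT₀ : ∀ y₀ : K₀, y₀ ∈ T₀ ↔ IsOfFinOrder y₀ ∧ ∃ p ∈ PA, y₀ ^ p ∈ X)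
    (hT₁ : ∀ ζ ∈ T₀, IsOfFinOrder ζ ∧ ζ ≠ 1)
    (hsplit : ∀ ζ ∈ T₀, ((Polynomial.X ^ 2 - Polynomial.C (4 * ζ - 2) * Polynomial.X + 1 :
      K₀[X]).map (algebraMap K₀ K₁)).Splits)
    {RC : ℝ} (hRC : ∀ β β' : K₁,
      (∃ ζ ∈ T₀, β ^ 2 - algebraMap K₀ K₁ (4 * ζ - 2) * β + 1 = 0) →
      (∃ ζ ∈ T₀, β' ^ 2 - algebraMap K₀ K₁ (4 * ζ - 2) * β' + 1 = 0) →
        0 < logHeight₁ β' → logHeight₁ β ≤ RC * logHeight₁ β')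
    (PC : Finset ℕ) (hPC : ∀ n ∈ PC, n.Prime)
    (hPCgrow : ∀ n ∈ PC, ∀ n' ∈ PC, n < n' → RC * n < n')
    (E : Type*) [NormedField E] [CharZero E] [IsAlgClosed E] (τ : K₀ →+* E) :
    ∃ r > 0, ∃ η > 0,
      (∀ u : E, ∀ p ∈ PA, ∀ p' ∈ PA, p ≠ p' →
        (∃ x ∈ τ '' (X : Set K₀), dist (u ^ p) x < r) →
        (∃ x ∈ τ '' (X : Set K₀), dist (u ^ p') x < r) →
          ∃ x ∈ τ '' (T₀ : Set K₀), dist u x < η) ∧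
      (∀ z : E, ∀ n ∈ PC, ∀ n' ∈ PC, n ≠ n' →
        (∃ x ∈ τ '' (T₀ : Set K₀),
          dist (((Polynomial.Chebyshev.C E n).eval (4 * z - 2) + 2) / 4) x < η) →
        (∃ x ∈ τ '' (T₀ : Set K₀),
          dist (((Polynomial.Chebyshev.C E n').eval (4 * z - 2) + 2) / 4) x < η) → False) := by
  have hXfin : (τ '' (X : Set K₀)).Finite := X.finite_toSet.image τ
  have hTfin : (τ '' (T₀ : Set K₀)).Finite := T₀.finite_toSet.image τ
  -- the outer family as polynomial maps
  have hfpow : ∀ p : ℕ, (fun u : E => u ^ p) = fun u => (Polynomial.X ^ p : E[X]).eval u := by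
    intro p; funext u; simp
  have hginn : ∀ n : ℕ, (fun u : E => ((Polynomial.Chebyshev.C E n).eval (4 * u - 2) + 2) / 4) =
      fun u => (Polynomial.C (4⁻¹ : E) * ((Polynomial.Chebyshev.C E n).comp
        (Polynomial.C 4 * Polynomial.X - Polynomial.C 2) + Polynomial.C 2)).eval u := by
    intro n; funext u; exact inner_eval_eq n u
  refine exists_radii PA PC (fun p u => u ^ p)
    (fun n u => ((Polynomial.Chebyshev.C E n).eval (4 * u - 2) + 2) / 4)
    (τ '' (X : Set K₀)) (τ '' (T₀ : Set K₀)) ?_ ?_ ?_ ?_ ?_ ?_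
  · -- finiteness of the outer preimages
    intro p hp
    rw [hfpow p]
    exact finite_preimage_eval _ (by rw [natDegree_X_pow]; exact (hPA p hp).pos) hXfin
  · -- outer persistence
    intro p hp p' hp' hne y hy hy'
    obtain ⟨y₀, htor, hpow, hy₀⟩ :=
      outer_persistence h0 hRA hPA hPAgrow τ hp hp' hne hy hy'
    exact ⟨y₀, by rw [Finset.mem_coe, hT₀]; exact ⟨htor, p, hp, hpow⟩, hy₀⟩
  · -- outer localization
    intro p hp
    change ∀ ε > 0, ∃ δ > 0, ∀ u : E, (∃ x ∈ τ '' (X : Set K₀), dist ((fun u : E => u ^ p) u) x < δ) →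
      ∃ y ∈ (fun u : E => u ^ p) ⁻¹' (τ '' (X : Set K₀)), dist u y < ε
    rw [hfpow p]
    exact localizes_eval _ (by rw [natDegree_X_pow]; exact (hPA p hp).pos) _
  · -- finiteness of the inner preimages
    intro n hn
    rw [hginn n]
    exact finite_preimage_eval _ (natDegree_inner_pos (hPC n hn).one_lt.le) hTfin
  · -- inner persistence
    intro n hn n' hn' hne y hy hy'
    exact inner_persistence T₀ hT₁ hsplit hRC hPC hPCgrow τ hn hn' hne hy hy'
  · -- inner localization
    intro n hn
    change ∀ ε > 0, ∃ δ > 0, ∀ u : E, (∃ x ∈ τ '' (T₀ : Set K₀),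
      dist ((fun u : E => ((Polynomial.Chebyshev.C E n).eval (4 * u - 2) + 2) / 4) u) x < δ) →
      ∃ y ∈ (fun u : E => ((Polynomial.Chebyshev.C E n).eval (4 * u - 2) + 2) / 4) ⁻¹'
        (τ '' (T₀ : Set K₀)), dist u y < ε
    rw [hginn n]
    exact localizes_eval _ (natDegree_inner_pos (hPC n hn).one_lt.le) _

/-- **THE MENU COVERING LEMMA** (depth 2: power ∘ conjugated Chebyshev).  For a number field `K₀`,
a finite `X ⊂ K₀` with `0, 1 ∉ X`, two algebraically closed normed fields `E₁, E₂` of characteristic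
zero with `τᵢ : K₀ →+* Eᵢ` (the places `∞` and `2`: `ℂ` and `Q̄_2`), and a slot budget `k`: there
are menus `PA, PC` of MORE than `k` odd primes and a radius `r > 0` such that for every choice of at
most `k` slots `Z₁ ⊂ E₁`, `Z₂ ⊂ E₂` some menu map `z ↦ ((C_n(4z−2)+2)/4)^p`, `n ∈ PC`, `p ∈ PA`,
puts every slot at distance `≥ r` from the bad set. [cite: MochizukiGenEll2010, Thm 2.1 p.12] -/
theorem exists_menu_cover {K₀ : Type u} [Field K₀] [NumberField K₀] (X : Finset K₀)
    (h0 : (0 : K₀) ∉ X) (h1 : (1 : K₀) ∉ X)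
    (E₁ : Type v) [NormedField E₁] [CharZero E₁] [IsAlgClosed E₁] (τ₁ : K₀ →+* E₁)
    (E₂ : Type w) [NormedField E₂] [CharZero E₂] [IsAlgClosed E₂] (τ₂ : K₀ →+* E₂) (k : ℕ) :
    ∃ PA PC : Finset ℕ, k < PA.card ∧ k < PC.card ∧
      (∀ p ∈ PA, p.Prime ∧ 3 ≤ p) ∧ (∀ n ∈ PC, n.Prime ∧ 3 ≤ n) ∧
      ∃ r > 0, ∀ (Z₁ : Finset E₁) (Z₂ : Finset E₂), Z₁.card + Z₂.card ≤ k →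
        ∃ n ∈ PC, ∃ p ∈ PA,
          (∀ z ∈ Z₁, ∀ a ∈ X,
            r ≤ dist ((((Polynomial.Chebyshev.C E₁ n).eval (4 * z - 2) + 2) / 4) ^ p) (τ₁ a)) ∧
          (∀ z ∈ Z₂, ∀ a ∈ X,
            r ≤ dist ((((Polynomial.Chebyshev.C E₂ n).eval (4 * z - 2) + 2) / 4) ^ p) (τ₂ a)) := by
  classical
  -- the outer menu
  obtain ⟨RA, -, hRA⟩ := exists_ratio_bound X (fun a => logHeight₁ a) (fun a _ => zero_le_logHeight₁ a)
  obtain ⟨PA, hPAcard, hPAprime, hPAgrow⟩ := exists_prime_menu RA 3 (k + 1)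
  have hPA : ∀ p ∈ PA, p.Prime := fun p hp => (hPAprime p hp).1
  -- the persistent set of the outer family
  have hT₀fin := finite_outerPersistent X PA (fun p hp => (hPA p hp).pos)
  set T₀ : Finset K₀ := hT₀fin.toFinset with hT₀def
  have hT₀ : ∀ y₀ : K₀, y₀ ∈ T₀ ↔ IsOfFinOrder y₀ ∧ ∃ p ∈ PA, y₀ ^ p ∈ X := by
    intro y₀; rw [hT₀def, Set.Finite.mem_toFinset]; rfl
  have hT₁ : ∀ ζ ∈ T₀, IsOfFinOrder ζ ∧ ζ ≠ 1 := by
    intro ζ hζ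
    obtain ⟨htor, p, hp, hpow⟩ := (hT₀ ζ).mp hζ
    refine ⟨htor, fun h => h1 ?_⟩
    rw [h, one_pow] at hpow; exact hpow
  -- the splitting field of the quadratics over the persistent roots of unity
  set Q : K₀[X] := ∏ ζ ∈ T₀, (Polynomial.X ^ 2 - Polynomial.C (4 * ζ - 2) * Polynomial.X + 1)
    with hQdef
  have hQaeval : ∀ (L : Type u) [Field L] [Algebra K₀ L] (β : L),
      aeval β Q = ∏ ζ ∈ T₀, (β ^ 2 - algebraMap K₀ L (4 * ζ - 2) * β + 1) := by
    intro L _ _ β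
    rw [hQdef, map_prod]
    refine Finset.prod_congr rfl fun ζ _ => ?_
    simp only [map_add, map_sub, map_pow, map_mul, aeval_X, aeval_C, map_one]
  let K₁ := Q.SplittingField
  haveI : CharZero K₁ := charZero_of_injective_algebraMap (algebraMap K₀ K₁).injective
  haveI : FiniteDimensional ℚ K₁ := Module.Finite.trans K₀ K₁
  haveI : NumberField K₁ := NumberField.mk
  have hQsplit : (Q.map (algebraMap K₀ K₁)).Splits := Polynomial.SplittingField.splits Q
  have hmonic : ∀ ζ : K₀, (Polynomial.X ^ 2 - Polynomial.C (4 * ζ - 2) * Polynomial.X + 1 :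
      K₀[X]).Monic := by
    intro ζ
    have : (Polynomial.X ^ 2 - Polynomial.C (4 * ζ - 2) * Polynomial.X + 1 : K₀[X]) =
        Polynomial.X ^ 2 + (Polynomial.C (-(4 * ζ - 2)) * Polynomial.X + Polynomial.C 1) := by
      simp only [map_neg, map_one, neg_mul]; ring
    rw [this]
    exact monic_X_pow_add (lt_of_le_of_lt degree_linear_le (by exact_mod_cast one_lt_two))
  have hQmonic : Q.Monic := by rw [hQdef]; exact monic_prod_of_monic _ _ fun ζ _ => hmonic ζ
  have hQ0 : Q.map (algebraMap K₀ K₁) ≠ 0 := (hQmonic.map _).ne_zero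
  have hsplit : ∀ ζ ∈ T₀, ((Polynomial.X ^ 2 - Polynomial.C (4 * ζ - 2) * Polynomial.X + 1 :
      K₀[X]).map (algebraMap K₀ K₁)).Splits := by
    intro ζ hζ
    refine hQsplit.of_dvd hQ0 (Polynomial.map_dvd _ ?_)
    rw [hQdef]; exact Finset.dvd_prod_of_mem _ hζ
  -- the inner menu: growth beyond the height quotients of the roots of `Q` in `K₁`
  set Roots : Finset K₁ := (Q.map (algebraMap K₀ K₁)).roots.toFinset with hRootsdef
  have hmemRoots : ∀ β : K₁, (∃ ζ ∈ T₀, β ^ 2 - algebraMap K₀ K₁ (4 * ζ - 2) * β + 1 = 0) →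
      β ∈ Roots := by
    rintro β ⟨ζ, hζ, hβ⟩
    rw [hRootsdef, Multiset.mem_toFinset, mem_roots hQ0, IsRoot.def, eval_map_algebraMap,
      hQaeval K₁ β, Finset.prod_eq_zero_iff]
    exact ⟨ζ, hζ, hβ⟩
  obtain ⟨RC, -, hRC⟩ :=
    exists_ratio_bound Roots (fun β => logHeight₁ β) (fun β _ => zero_le_logHeight₁ β)
  have hRC' : ∀ β β' : K₁,
      (∃ ζ ∈ T₀, β ^ 2 - algebraMap K₀ K₁ (4 * ζ - 2) * β + 1 = 0) →
      (∃ ζ ∈ T₀, β' ^ 2 - algebraMap K₀ K₁ (4 * ζ - 2) * β' + 1 = 0) →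
        0 < logHeight₁ β' → logHeight₁ β ≤ RC * logHeight₁ β' :=
    fun β β' hβ hβ' hpos => hRC β (hmemRoots β hβ) β' (hmemRoots β' hβ') hpos
  obtain ⟨PC, hPCcard, hPCprime, hPCgrow⟩ := exists_prime_menu RC 3 (k + 1)
  have hPC : ∀ n ∈ PC, n.Prime := fun n hn => (hPCprime n hn).1
  -- radii in both slot spaces
  obtain ⟨r₁, hr₁, η₁, hη₁, hout₁, hinn₁⟩ := exists_radii_menu X h0 hRA PA hPA hPAgrow T₀ hT₀ hT₁
    hsplit hRC' PC hPC hPCgrow E₁ τ₁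
  obtain ⟨r₂, hr₂, η₂, hη₂, hout₂, hinn₂⟩ := exists_radii_menu X h0 hRA PA hPA hPAgrow T₀ hT₀ hT₁
    hsplit hRC' PC hPC hPCgrow E₂ τ₂
  refine ⟨PA, PC, by omega, by omega, hPAprime, hPCprime, min r₁ r₂, lt_min hr₁ hr₂, ?_⟩
  intro Z₁ Z₂ hZ
  obtain ⟨n, hn, p, hp, hgood₁, hgood₂⟩ := exists_good_pair₂ PA PC
    (fun p (u : E₁) => u ^ p)
    (fun n (u : E₁) => ((Polynomial.Chebyshev.C E₁ n).eval (4 * u - 2) + 2) / 4)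
    (τ₁ '' (X : Set K₀)) (τ₁ '' (T₀ : Set K₀)) r₁ η₁
    (fun p (u : E₂) => u ^ p)
    (fun n (u : E₂) => ((Polynomial.Chebyshev.C E₂ n).eval (4 * u - 2) + 2) / 4)
    (τ₂ '' (X : Set K₀)) (τ₂ '' (T₀ : Set K₀)) r₂ η₂
    hout₁ hinn₁ hout₂ hinn₂ Z₁ Z₂ (by omega) (by omega)
  refine ⟨n, hn, p, hp, fun z hz a ha => ?_, fun z hz a ha => ?_⟩
  · exact le_trans (min_le_left _ _) (hgood₁ z hz (τ₁ a) ⟨a, ha, rfl⟩)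
  · exact le_trans (min_le_right _ _) (hgood₂ z hz (τ₂ a) ⟨a, ha, rfl⟩)

/-- A ring homomorphism commutes with the menu map (a polynomial map over `ℚ`):
`σ(γ_{n,p}(x)) = γ_{n,p}(σ x)`. [folklore] -/
theorem map_menu {F E : Type*} [Field F] [Field E] (σ : F →+* E) (n p : ℕ) (x : F) :
    σ ((((Polynomial.Chebyshev.C F n).eval (4 * x - 2) + 2) / 4) ^ p) =
      (((Polynomial.Chebyshev.C E n).eval (4 * σ x - 2) + 2) / 4) ^ p := by
  have h : σ ((Polynomial.Chebyshev.C F n).eval (4 * x - 2)) =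
      (Polynomial.Chebyshev.C E n).eval (σ (4 * x - 2)) := by
    rw [← Polynomial.eval₂_hom, ← Polynomial.eval_map, Polynomial.Chebyshev.map_C]
  rw [map_pow, map_div₀, map_add, h, map_sub, map_mul, map_ofNat, map_ofNat]

/-- **THE MENU COVERING LEMMA, conjugate form** (what the `GenEllTwo` assembly consumes).  For a
number field `K₀`, a finite `X ⊂ K₀` with `0, 1 ∉ X`, embeddings `τ₁ : K₀ →+* ℂ`,
`τ₂ : K₀ →+* Q̄_ℓ` and a degree bound `d`: there are menus `PA, PC` of more than `2d` odd primes
and `r > 0` such that for EVERY number field `F` of degree `≤ d` and every `x ∈ F` some menu map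
`γ_{n,p}` has ALL conjugates of `γ_{n,p}(x)` — at `∞` (every `σ : F →+* ℂ`) and at `ℓ` (every
`σ : F →+* Q̄_ℓ`) — at distance `≥ r` from `τ₁(X)`, resp. `τ₂(X)` (the `≤ 2d` conjugates are the
slots). [cite: MochizukiGenEll2010, Thm 2.1 p.12] -/
theorem exists_menu_cover_conjugates {K₀ : Type u} [Field K₀] [NumberField K₀]
    (X : Finset K₀) (h0 : (0 : K₀) ∉ X) (h1 : (1 : K₀) ∉ X) (τ₁ : K₀ →+* ℂ)
    (ℓ : ℕ) [Fact ℓ.Prime] (τ₂ : K₀ →+* PadicAlgCl ℓ) (d : ℕ) :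
    ∃ PA PC : Finset ℕ, 2 * d < PA.card ∧ 2 * d < PC.card ∧
      (∀ p ∈ PA, p.Prime ∧ 3 ≤ p) ∧ (∀ n ∈ PC, n.Prime ∧ 3 ≤ n) ∧
      ∃ r > 0, ∀ (F : Type) [Field F] [NumberField F], Module.finrank ℚ F ≤ d → ∀ x : F,
        ∃ n ∈ PC, ∃ p ∈ PA,
          (∀ σ : F →+* ℂ, ∀ a ∈ X,
            r ≤ dist (σ ((((Polynomial.Chebyshev.C F n).eval (4 * x - 2) + 2) / 4) ^ p)) (τ₁ a)) ∧
          (∀ σ : F →+* PadicAlgCl ℓ, ∀ a ∈ X,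
            r ≤ dist (σ ((((Polynomial.Chebyshev.C F n).eval (4 * x - 2) + 2) / 4) ^ p)) (τ₂ a)) := by
  classical
  obtain ⟨PA, PC, hPA, hPC, hPAp, hPCp, r, hr, hcover⟩ :=
    exists_menu_cover X h0 h1 ℂ τ₁ (PadicAlgCl ℓ) τ₂ (2 * d)
  refine ⟨PA, PC, hPA, hPC, hPAp, hPCp, r, hr, ?_⟩
  intro F _ _ hF x
  -- the slots: the conjugates of `x` at `∞` and at `ℓ`
  let Z₁ : Finset ℂ := Finset.univ.image fun σ : F →+* ℂ => σ x
  let Z₂ : Finset (PadicAlgCl ℓ) := Finset.univ.image fun σ : F →+* PadicAlgCl ℓ => σ x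
  have hZ₁ : Z₁.card ≤ d :=
    le_trans Finset.card_image_le (by rw [Finset.card_univ, NumberField.Embeddings.card]; exact hF)
  have hZ₂ : Z₂.card ≤ d :=
    le_trans Finset.card_image_le (by rw [Finset.card_univ, NumberField.Embeddings.card]; exact hF)
  obtain ⟨n, hn, p, hp, hgood₁, hgood₂⟩ := hcover Z₁ Z₂ (by omega)
  refine ⟨n, hn, p, hp, fun σ a ha => ?_, fun σ a ha => ?_⟩
  · rw [map_menu]
    exact hgood₁ (σ x) (Finset.mem_image.mpr ⟨σ, Finset.mem_univ _, rfl⟩) a ha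
  · rw [map_menu]
    exact hgood₂ (σ x) (Finset.mem_image.mpr ⟨σ, Finset.mem_univ _, rfl⟩) a ha

end Summit.ABC.ABC.Theorems.GenEllTwo.MenuCovering

end
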